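/-
Origin: expansion seat `prover-pub-hodgecm-mc-binder-1-g12-0`, handover #59 2026-08-20T11:37:48Z md5 feb133b28d2f (NEW additive KERNEL leaf; imports #58 + vendored ArchFollandTorusAdelic; drop rule #58 ⇒ {#59}) (`HOME/mc/pub-hodgecm-mc-binder-1-g12/stage50/HodgeCM/Model/Binders/Real34ScaledFrameSubst.lean`, md5 feb133b28d2f, 181 lines);
landed by the second packager p2 gen 7 (p2-g7) in gate run 50 as `HodgeCM/Model/Binders/Real34ScaledFrameSubst.lean` (verbatim).
-/
/-
Origin: pub-hodgecm MODEL-CONSTRUCTION sub-cell (Hodge conjecture, CM-per-L package), seat mc-binder-1 gen 12, session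
prover-pub-hodgecm-mc-binder-1-g12-0, 2026-08-20.  Target in PKG: HodgeCM/Model/Binders/Real34ScaledFrameSubst.lean (NEW additive leaf; imports RUN-50 #58
`Binders/Real34FollandRename` + vendored `Weil1964/ArchFollandTorusAdelic`).  KERNEL MATHEMATICS ONLY: no `def … : Prop`, no `axiom`, no proof hole.
Consumer: the archimedean letter identity `harch` of the row-17 socket (#56 `Binders/Real34Census`), ingredient (ii″) of
`mc/pub-hodgecm-mc-binder-1-g12/HARCH-PLAN.md` §2′/§4: the real Levi substitution `S_m` on Folland letters of SCALED frames.
-/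
import Summits.HodgeConjecture.HodgeCM.Model.Binders.Real34FollandRename
import Literature.NumberTheory.Weil1964.ArchFollandTorusAdelic

/-!
# Row 17 (`real34`), archimedean letters: place-wise MONOMIAL substitutions of scaled Folland frames

For a totally real `F`, an index type `ι` and the tree's scaled real-place frame `scaledFrame F ι D hD : (ι → F ⊗ ℝ) ≃L[ℝ] ℝ^{ι × places}`,
`a ↦ ((j, v) ↦ D_{j,v} · (a_j)_v)` (`Weil1964/ArchFollandTorusAdelic`), and a PLACE-WISE MONOMIAL SUBSTITUTION of the archimedean vectors —
a permutation `π_v` of `ι` and non-zero real scalings `s_{j,v}` at every real place `v`,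
`monoSubst π s hs : (ι → F ⊗ ℝ) ≃L[ℝ] (ι → F ⊗ ℝ)`, `(monoSubst x)_j,v = s_{j,v} · (x_{π_v j})_v` — this file proves

* `scaledFrame_monoSubst`: `scaledFrame D (monoSubst π s x) = relabelCLE (monoIdx π) (scaledFrame (monoScale π s D) x)` — a monomial substitution
  followed by a scaled frame IS a scaled frame (scalings `D_{π_v⁻¹ j, v} · s_{π_v⁻¹ j, v}`) followed by the coordinate relabelling
  `monoIdx π : (j, v) ↦ (π_v⁻¹ j, v)`;
* **`comp_monoSubst_follandFock_scaledFrame`**: `(follandFock (scaledFrame D) P) ∘ monoSubst π s = follandFock (scaledFrame (monoScale π s D)) (rename (monoIdx π)⁻¹ P)`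
  (as Schwartz functions, via Mathlib `SchwartzMap.compCLMOfContinuousLinearEquiv`) — substituting a Folland letter of a scaled frame by a place-wise
  monomial map gives the RENAMED letter of the RESCALED frame (#58 `follandFock_rename_equiv`).

Use (HARCH-PLAN §2′/§4): the archimedean factor of `ω(leviPair m)`, `m = Λ_C ∘ Res(1 ⊗ isoMat⁻¹)`, is `Φ ↦ Φ ∘ (1 ⊗ isoMat)` with `isoMat_v = P_{σ_v} · diag(√(b'/a_σ))`
(binder-2 #52 `IsoTwist`) — a `monoSubst` on `ι = Fin 3 × Fin 2` permuting the `W`-index place-wise; `cmBigFrame = scaledFrame … (pairScale …)`; so the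
census side of (A″) is `follandFock (scaledFrame (monoScale …)) (rename … (det z · ∏ letters))`, to be compared with the line side through #57/#58.

## References
* [Folland1989] G. B. Folland, *Harmonic Analysis in Phase Space*, Princeton UP (1989), §1.7 (1.81), §4.2 (the metaplectic representation on the
  Siegel–Levi factor: substitution operators).
-/

set_option autoImplicit false

noncomputable section

open NumberField NumberField.InfinitePlace NumberField.mixedEmbedding MvPolynomial
open Literature.Analysis.SegalBargmann Literature.NumberTheory.Weil1964 Literature.NumberTheory.Automorphic

namespace HodgeCM.Model

open scoped Classical

/-! ## §1 Place-wise monomial substitutions -/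

section Subst

variable {F : Type} [Field F] [NumberField F] {ι : Type} [Fintype ι]

/-- **Place-wise monomial substitution** of archimedean vectors: `(monoSubst π s hs x)_j` has `v`-component `s_{j,v} · (x_{π_v j})_v` at the real
places `v` (the complex-place components are kept as they are; for `F` totally real there are none). [folklore] -/
def monoSubst (π : {v : InfinitePlace F // v.IsReal} → Equiv.Perm ι) (s : ι × {v : InfinitePlace F // v.IsReal} → ℝ) (hs : ∀ k, s k ≠ 0) :
    (ι → mixedSpace F) ≃L[ℝ] (ι → mixedSpace F) :=
  LinearEquiv.toContinuousLinearEquiv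
    { toFun := fun x j => (fun v => s (j, v) * (x (π v j)).1 v, (x j).2)
      invFun := fun y j => (fun v => (y ((π v).symm j)).1 v / s ((π v).symm j, v), (y j).2)
      map_add' := fun x y => by
        funext j
        refine Prod.ext (funext fun v => ?_) rfl
        simp only [Pi.add_apply, Prod.fst_add, mul_add]
      map_smul' := fun c x => by
        funext j
        refine Prod.ext (funext fun v => ?_) rfl
        simp only [Pi.smul_apply, Prod.smul_fst, smul_eq_mul, RingHom.id_apply]
        ring
      left_inv := fun x => by
        funext j
        refine Prod.ext (funext fun v => ?_) rfl
        simp only [Equiv.apply_symm_apply, mul_div_cancel_left₀ _ (hs ((π v).symm j, v))]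
      right_inv := fun y => by
        funext j
        refine Prod.ext (funext fun v => ?_) rfl
        simp only [Equiv.symm_apply_apply, mul_div_cancel₀ _ (hs (j, v))] }

/-- Pointwise, real component: `((monoSubst π s hs x) j).1 v = s (j, v) * (x (π v j)).1 v`. [folklore] -/
@[simp] theorem monoSubst_apply_fst (π : {v : InfinitePlace F // v.IsReal} → Equiv.Perm ι)
    (s : ι × {v : InfinitePlace F // v.IsReal} → ℝ) (hs : ∀ k, s k ≠ 0) (x : ι → mixedSpace F) (j : ι)
    (v : {v : InfinitePlace F // v.IsReal}) : ((monoSubst π s hs x) j).1 v = s (j, v) * (x (π v j)).1 v := rfl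

/-- Pointwise, complex component (untouched). [folklore] -/
@[simp] theorem monoSubst_apply_snd (π : {v : InfinitePlace F // v.IsReal} → Equiv.Perm ι)
    (s : ι × {v : InfinitePlace F // v.IsReal} → ℝ) (hs : ∀ k, s k ≠ 0) (x : ι → mixedSpace F) (j : ι) :
    ((monoSubst π s hs x) j).2 = (x j).2 := rfl

end Subst

/-! ## §2 The induced relabelling and rescaling of the frame coordinates -/

section Idx

variable {F : Type} [Field F] {ι : Type}

/-- The coordinate relabelling of a place-wise permutation: `monoIdx π (j, v) = (π_v⁻¹ j, v)`. [folklore] -/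
def monoIdx (π : {v : InfinitePlace F // v.IsReal} → Equiv.Perm ι) :
    Equiv.Perm (ι × {v : InfinitePlace F // v.IsReal}) where
  toFun k := ((π k.2).symm k.1, k.2)
  invFun k := (π k.2 k.1, k.2)
  left_inv k := by simp only [Equiv.apply_symm_apply]
  right_inv k := by simp only [Equiv.symm_apply_apply]

/-- see `monoIdx`. [folklore] -/
@[simp] theorem monoIdx_apply (π : {v : InfinitePlace F // v.IsReal} → Equiv.Perm ι) (k : ι × {v : InfinitePlace F // v.IsReal}) :
    monoIdx π k = ((π k.2).symm k.1, k.2) := rfl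

/-- see `monoIdx`. [folklore] -/
@[simp] theorem monoIdx_symm_apply (π : {v : InfinitePlace F // v.IsReal} → Equiv.Perm ι) (k : ι × {v : InfinitePlace F // v.IsReal}) :
    (monoIdx π).symm k = (π k.2 k.1, k.2) := rfl

/-- The rescaled frame scalings: `monoScale π s D (j, v) = D (π_v⁻¹ j, v) * s (π_v⁻¹ j, v)`. [folklore] -/
def monoScale (π : {v : InfinitePlace F // v.IsReal} → Equiv.Perm ι) (s D : ι × {v : InfinitePlace F // v.IsReal} → ℝ) :
    ι × {v : InfinitePlace F // v.IsReal} → ℝ :=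
  fun k => D ((π k.2).symm k.1, k.2) * s ((π k.2).symm k.1, k.2)

/-- see `monoScale`. [folklore] -/
@[simp] theorem monoScale_apply (π : {v : InfinitePlace F // v.IsReal} → Equiv.Perm ι) (s D : ι × {v : InfinitePlace F // v.IsReal} → ℝ)
    (k : ι × {v : InfinitePlace F // v.IsReal}) : monoScale π s D k = D ((π k.2).symm k.1, k.2) * s ((π k.2).symm k.1, k.2) := rfl

/-- The rescaled scalings are non-zero. [folklore] -/
theorem monoScale_ne_zero (π : {v : InfinitePlace F // v.IsReal} → Equiv.Perm ι) {s D : ι × {v : InfinitePlace F // v.IsReal} → ℝ}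
    (hs : ∀ k, s k ≠ 0) (hD : ∀ k, D k ≠ 0) (k : ι × {v : InfinitePlace F // v.IsReal}) : monoScale π s D k ≠ 0 :=
  mul_ne_zero (hD _) (hs _)

end Idx

/-! ## §3 Scaled frames and their Folland letters after a monomial substitution -/

section Frames

variable {F : Type} [Field F] [NumberField F] [IsTotallyReal F] {ι : Type} [Fintype ι]

/-- **A monomial substitution followed by a scaled frame is a rescaled frame followed by a relabelling**:
`scaledFrame D (monoSubst π s x) = relabelCLE (monoIdx π) (scaledFrame (monoScale π s D) x)`. [folklore] -/
theorem scaledFrame_monoSubst (π : {v : InfinitePlace F // v.IsReal} → Equiv.Perm ι)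
    {s D : ι × {v : InfinitePlace F // v.IsReal} → ℝ} (hs : ∀ k, s k ≠ 0) (hD : ∀ k, D k ≠ 0) (x : ι → mixedSpace F) :
    scaledFrame F ι D hD (monoSubst π s hs x) =
      relabelCLE (monoIdx π) (scaledFrame F ι (monoScale π s D) (monoScale_ne_zero π hs hD) x) := by
  funext k
  obtain ⟨j, v⟩ := k
  rw [scaledFrame_apply, relabelCLE_apply, scaledFrame_apply, monoIdx_symm_apply, monoScale_apply, monoSubst_apply_fst]
  simp only [Equiv.symm_apply_apply]
  ring

/-- The same as an identity of continuous linear equivalences: `monoSubst ≫ scaledFrame D = scaledFrame (monoScale D) ≫ relabelCLE (monoIdx π)`. [folklore] -/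
theorem monoSubst_trans_scaledFrame (π : {v : InfinitePlace F // v.IsReal} → Equiv.Perm ι)
    {s D : ι × {v : InfinitePlace F // v.IsReal} → ℝ} (hs : ∀ k, s k ≠ 0) (hD : ∀ k, D k ≠ 0) :
    (monoSubst π s hs).trans (scaledFrame F ι D hD) =
      (scaledFrame F ι (monoScale π s D) (monoScale_ne_zero π hs hD)).trans (relabelCLE (monoIdx π)) := by
  ext x k
  rw [ContinuousLinearEquiv.trans_apply, ContinuousLinearEquiv.trans_apply, scaledFrame_monoSubst]

variable [DecidableEq ι]

/-- **Substituting a Folland letter of a scaled frame by a place-wise monomial map gives the renamed letter of the rescaled frame** (pointwise):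
`follandFock (scaledFrame D) P (monoSubst π s x) = follandFock (scaledFrame (monoScale π s D)) (rename (monoIdx π)⁻¹ P) x`.
[cite: Folland1989, §1.7 (1.81), §4.2] -/
theorem follandFock_scaledFrame_monoSubst_apply (π : {v : InfinitePlace F // v.IsReal} → Equiv.Perm ι)
    {s D : ι × {v : InfinitePlace F // v.IsReal} → ℝ} (hs : ∀ k, s k ≠ 0) (hD : ∀ k, D k ≠ 0)
    (P : MvPolynomial (ι × {v : InfinitePlace F // v.IsReal}) ℂ) (x : ι → mixedSpace F) :
    follandFock (scaledFrame F ι D hD) P (monoSubst π s hs x) =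
      follandFock (scaledFrame F ι (monoScale π s D) (monoScale_ne_zero π hs hD)) (rename (monoIdx π).symm P) x := by
  rw [follandFock_apply, follandFock_rename_equiv_apply, scaledFrame_monoSubst]
  rfl

/-- The same as Schwartz functions (Mathlib `SchwartzMap.compCLMOfContinuousLinearEquiv`):
`(follandFock (scaledFrame D) P) ∘ (monoSubst π s) = follandFock (scaledFrame (monoScale π s D)) (rename (monoIdx π)⁻¹ P)`.
[cite: Folland1989, §1.7 (1.81), §4.2] -/
theorem comp_monoSubst_follandFock_scaledFrame (π : {v : InfinitePlace F // v.IsReal} → Equiv.Perm ι)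
    {s D : ι × {v : InfinitePlace F // v.IsReal} → ℝ} (hs : ∀ k, s k ≠ 0) (hD : ∀ k, D k ≠ 0)
    (P : MvPolynomial (ι × {v : InfinitePlace F // v.IsReal}) ℂ) :
    SchwartzMap.compCLMOfContinuousLinearEquiv ℂ (monoSubst π s hs) (follandFock (scaledFrame F ι D hD) P) =
      follandFock (scaledFrame F ι (monoScale π s D) (monoScale_ne_zero π hs hD)) (rename (monoIdx π).symm P) := by
  ext x
  rw [SchwartzMap.compCLMOfContinuousLinearEquiv_apply, Function.comp_apply, follandFock_scaledFrame_monoSubst_apply]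

end Frames

end HodgeCM.Model

end
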